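import Summits.AtomisticToContinuum.FouriersLaw.Theorems.BondHeatUncertaintySubdiffusiveBondHeatSmoothDenseL2
import Summits.AtomisticToContinuum.FouriersLaw.Theorems.ContactStieltjesMeasureStieltjesRepresentationPencilIBP
import Mathlib.Analysis.InnerProductSpace.ProdL2
import Mathlib.MeasureTheory.Function.L2Space

/-!
# Stub `stub_pencilOfGreenKubo` of line `cayley-pencil` (crux `ContactStieltjesMeasure.StieltjesRepresentation`,
# stmt-AtomisticToContinuum-15248), part 6b: pairs of test functions are dense in `L²(μ)²`, and test functions are nice

Helper file (`--supports stmt-AtomisticToContinuum-15248`). For a finite Borel measure `μ` on phase space and the Hilbert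
space `K = L²(μ) ⊕₂ L²(μ)` (`WithLp 2 (Lp ℝ 2 μ × Lp ℝ 2 μ)`):

* `exists_testPair_near` — every `x ∈ K` is within `ε` of a pair `(φ, ψ)` of `C_c^∞` functions (the tree's
  `stub_smoothDenseL2` in each component);
* `testFunction_nice` — a `C_c^∞` function `φ` on the phase space of the pinned chain is a NICE component:
  `|φ|, |∂_{p_0}φ|, |∂_{p_{N-1}}φ| ≤ A e^{H/(16T)}` (bounded with compact support, `H ≥ 0`).
So the nice pairs of the pencil core are dense in `K`. No definitions.
-/

noncomputable section

open MeasureTheory Filter Topology Set Function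
open scoped ContDiff NNReal ENNReal
open Literature.MathematicalPhysics.KineticTheory.HeatConduction

namespace Summit.AtomisticToContinuum.FouriersLaw.Theorems.ContactStieltjesMeasure.CayleyPencil

namespace Pencil

variable {N : ℕ}

/-- `‖toLp h - toLp φ‖² = ∫ (h - φ)² dμ` in `L²(μ)`. [folklore] -/
theorem norm_toLp_sub_toLp_sq {μ : Measure (PhaseSpace N)} {h φ : PhaseSpace N → ℝ} (hh : MemLp h 2 μ)
    (hφ : MemLp φ 2 μ) : ‖hh.toLp h - hφ.toLp φ‖ ^ 2 = ∫ x, (h x - φ x) ^ 2 ∂μ := by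
  rw [← MemLp.toLp_sub hh hφ, ← real_inner_self_eq_norm_sq, L2.inner_def]
  refine integral_congr_ae ?_
  filter_upwards [MemLp.coeFn_toLp (hh.sub hφ)] with x hx
  rw [hx]
  simp only [RCLike.inner_apply, conj_trivial, Pi.sub_apply]
  ring

/-- **Pairs of test functions are dense in `L²(μ) ⊕₂ L²(μ)`** (finite `μ`): for `x ∈ K` and `ε > 0` there are `C_c^∞`
functions `φ, ψ` with `‖x - (φ, ψ)‖ < ε`. [folklore] -/
theorem exists_testPair_near (μ : Measure (PhaseSpace N)) [IsFiniteMeasure μ]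
    (x : WithLp 2 (Lp ℝ 2 μ × Lp ℝ 2 μ)) {ε : ℝ} (hε : 0 < ε) :
    ∃ (φ ψ : PhaseSpace N → ℝ) (hφ : MemLp φ 2 μ) (hψ : MemLp ψ 2 μ),
      ContDiff ℝ ∞ φ ∧ HasCompactSupport φ ∧ ContDiff ℝ ∞ ψ ∧ HasCompactSupport ψ ∧
      ‖x - WithLp.toLp 2 (hφ.toLp φ, hψ.toLp ψ)‖ < ε := by
  -- representatives of the two components
  have h1 : MemLp (x.fst : PhaseSpace N → ℝ) 2 μ := Lp.memLp x.fst
  have h2 : MemLp (x.snd : PhaseSpace N → ℝ) 2 μ := Lp.memLp x.snd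
  have hε4 : 0 < ε ^ 2 / 4 := by positivity
  obtain ⟨φ, hφs, hφc, hφn⟩ := SubdiffusiveBondHeat.stub_smoothDenseL2 N μ _ h1 (ε ^ 2 / 4) hε4
  obtain ⟨ψ, hψs, hψc, hψn⟩ := SubdiffusiveBondHeat.stub_smoothDenseL2 N μ _ h2 (ε ^ 2 / 4) hε4
  have hφm : MemLp φ 2 μ := hφs.continuous.memLp_of_hasCompactSupport hφc
  have hψm : MemLp ψ 2 μ := hψs.continuous.memLp_of_hasCompactSupport hψc
  refine ⟨φ, ψ, hφm, hψm, hφs, hφc, hψs, hψc, ?_⟩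
  have e1 : h1.toLp _ = x.fst := Lp.toLp_coeFn _ _
  have e2 : h2.toLp _ = x.snd := Lp.toLp_coeFn _ _
  have hdiff : x - WithLp.toLp 2 (hφm.toLp φ, hψm.toLp ψ) =
      WithLp.toLp 2 (x.fst - hφm.toLp φ, x.snd - hψm.toLp ψ) := rfl
  have hsq : ‖x - WithLp.toLp 2 (hφm.toLp φ, hψm.toLp ψ)‖ ^ 2 < ε ^ 2 := by
    rw [hdiff, WithLp.prod_norm_sq_eq_of_L2]
    show ‖x.fst - hφm.toLp φ‖ ^ 2 + ‖x.snd - hψm.toLp ψ‖ ^ 2 < ε ^ 2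
    rw [show x.fst - hφm.toLp φ = h1.toLp _ - hφm.toLp φ by rw [e1],
      show x.snd - hψm.toLp ψ = h2.toLp _ - hψm.toLp ψ by rw [e2],
      norm_toLp_sub_toLp_sq h1 hφm, norm_toLp_sub_toLp_sq h2 hψm]
    linarith
  exact (pow_lt_pow_iff_left₀ (norm_nonneg _) hε.le two_ne_zero).1 hsq

/-- **Test functions are nice components** for the pinned chain (`ω₂ > 0`, `lam, β ≥ 0`, `T > 0`): a `C_c^∞` function `φ` has
`|φ|, |∂_{p_0}φ|, |∂_{p_{N-1}}φ| ≤ A e^{H/(16T)}` for some `A ≥ 0` (continuous compactly supported functions are bounded, and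
`e^{H/(16T)} ≥ 1`). [folklore] -/
theorem testFunction_nice {ω₂ lam β : ℝ} (hω : 0 < ω₂) (hl : 0 ≤ lam) (hβ : 0 ≤ β) (γ : ℝ) (hN : 2 ≤ N) {T : ℝ}
    (hT : 0 < T) {φ : PhaseSpace N → ℝ} (hφ : ContDiff ℝ ∞ φ) (hφc : HasCompactSupport φ) :
    ∃ A : ℝ, 0 ≤ A ∧ ∀ y : PhaseSpace N,
      |φ y| ≤ A * Real.exp ((pinnedChain ω₂ lam β γ).hamiltonian N y / (16 * T)) ∧
      |partialP ⟨0, by omega⟩ φ y| ≤ A * Real.exp ((pinnedChain ω₂ lam β γ).hamiltonian N y / (16 * T)) ∧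
      |partialP ⟨N - 1, by omega⟩ φ y| ≤ A * Real.exp ((pinnedChain ω₂ lam β γ).hamiltonian N y / (16 * T)) := by
  have hφd : Differentiable ℝ φ := hφ.differentiable (by simp)
  have hb : ∀ {g : PhaseSpace N → ℝ}, Continuous g → HasCompactSupport g → ∃ C, 0 ≤ C ∧ ∀ y, |g y| ≤ C := by
    intro g hg hgc
    obtain ⟨C, hC⟩ := hg.bounded_above_of_compact_support hgc
    refine ⟨max C 0, le_max_right _ _, fun y => (hC y).trans (le_max_left _ _)⟩
  obtain ⟨C₀, hC₀0, hC₀⟩ := hb hφ.continuous hφc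
  obtain ⟨C₁, hC₁0, hC₁⟩ := hb (continuous_partialP hφ (by simp) ⟨0, by omega⟩) (hasCompactSupport_partialP hφd hφc _)
  obtain ⟨C₂, hC₂0, hC₂⟩ := hb (continuous_partialP hφ (by simp) ⟨N - 1, by omega⟩) (hasCompactSupport_partialP hφd hφc _)
  refine ⟨C₀ + C₁ + C₂, by positivity, fun y => ?_⟩
  have he : 1 ≤ Real.exp ((pinnedChain ω₂ lam β γ).hamiltonian N y / (16 * T)) :=
    Real.one_le_exp (div_nonneg (pinnedChain_hamiltonian_nonneg hω.le hl hβ γ N y) (by positivity))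
  refine ⟨?_, ?_, ?_⟩
  · calc |φ y| ≤ C₀ := hC₀ y
      _ ≤ (C₀ + C₁ + C₂) * 1 := by linarith
      _ ≤ (C₀ + C₁ + C₂) * Real.exp ((pinnedChain ω₂ lam β γ).hamiltonian N y / (16 * T)) :=
          mul_le_mul_of_nonneg_left he (by positivity)
  · calc |partialP ⟨0, by omega⟩ φ y| ≤ C₁ := hC₁ y
      _ ≤ (C₀ + C₁ + C₂) * 1 := by linarith
      _ ≤ (C₀ + C₁ + C₂) * Real.exp ((pinnedChain ω₂ lam β γ).hamiltonian N y / (16 * T)) :=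
          mul_le_mul_of_nonneg_left he (by positivity)
  · calc |partialP ⟨N - 1, by omega⟩ φ y| ≤ C₂ := hC₂ y
      _ ≤ (C₀ + C₁ + C₂) * 1 := by linarith
      _ ≤ (C₀ + C₁ + C₂) * Real.exp ((pinnedChain ω₂ lam β γ).hamiltonian N y / (16 * T)) :=
          mul_le_mul_of_nonneg_left he (by positivity)

end Pencil

/-! ## Registered helper stub -/

open Pencil in
/-- **Registered sub-goal `stub_pencilOfGreenKubo_testNice`** of the crux (this file's ticket): test functions are nice
components (= `Pencil.testFunction_nice`). [folklore] -/
theorem stub_pencilOfGreenKubo_testNice :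
    ∀ (N : ℕ) (ω₂ lam β : ℝ), 0 < ω₂ → 0 ≤ lam → 0 ≤ β → ∀ (γ : ℝ) (hN : 2 ≤ N) (T : ℝ), 0 < T → ∀ (φ : Literature.MathematicalPhysics.KineticTheory.HeatConduction.PhaseSpace N → ℝ), ContDiff ℝ ((⊤ : ℕ∞) : WithTop ℕ∞) φ → HasCompactSupport φ → ∃ A : ℝ, 0 ≤ A ∧ ∀ y : Literature.MathematicalPhysics.KineticTheory.HeatConduction.PhaseSpace N, |φ y| ≤ A * Real.exp ((Literature.MathematicalPhysics.KineticTheory.HeatConduction.pinnedChain ω₂ lam β γ).hamiltonian N y / (16 * T)) ∧ |Literature.MathematicalPhysics.KineticTheory.HeatConduction.partialP ⟨0, by omega⟩ φ y| ≤ A * Real.exp ((Literature.MathematicalPhysics.KineticTheory.HeatConduction.pinnedChain ω₂ lam β γ).hamiltonian N y / (16 * T)) ∧ |Literature.MathematicalPhysics.KineticTheory.HeatConduction.partialP ⟨N - 1, by omega⟩ φ y| ≤ A * Real.exp ((Literature.MathematicalPhysics.KineticTheory.HeatConduction.pinnedChain ω₂ lam β γ).hamiltonian N y / (16 * T)) 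:=
  fun _ _ _ _ hω hl hβ γ hN _ hT _ hφ hφc => testFunction_nice hω hl hβ γ hN hT hφ hφc

end Summit.AtomisticToContinuum.FouriersLaw.Theorems.ContactStieltjesMeasure.CayleyPencil

end
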